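import Summits.ValiantsHypothesis.ValiantsHypothesis.Theses.UlrichPadded
import Summits.ValiantsHypothesis.ValiantsHypothesis.Theorems.UlrichPaddedPermHypersurfaceFactorialMissingPartial
import Summits.ValiantsHypothesis.ValiantsHypothesis.Theorems.UlrichPaddedPermHypersurfaceFactorialRegularOfPderiv
import Summits.ValiantsHypothesis.ValiantsHypothesis.Theorems.UlrichPaddedPermHypersurfaceFactorialLocalFactorial
import Summits.ValiantsHypothesis.ValiantsHypothesis.Theorems.UlrichPaddedPermHypersurfaceFactorialGradedDescent

/-!
# `UlrichPadded.PermHypersurfaceFactorial` (stmt-ValiantsHypothesis-5666): the permanental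
hypersurface ring `ℂ[x_{n×n}]/(per_n)` is factorial for `n ≥ 3`

The crux of route `UlrichPadded` (card engine (ii), `Cl(ℂ[x]/(per_n)) = 0`):

  `∀ n ≥ 3, ∀ P : Ideal (ℂ[x_ij] ⧸ (per_n)), P.IsPrime → P.height = 1 → P.IsPrincipal`,

i.e. every height-one prime of `S_n = ℂ[x_{n×n}]/(per_n)` is principal — for this noetherian domain,
exactly "`S_n` is a UFD".  It is FALSE at `n = 2` (the quadric cone `x₀₀x₁₁ + x₀₁x₁₀`, `Cl = ℤ`;
crux Disproof `permHypersurfaceFactorial_false_without_three_le`) and for the determinant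
(`Cl(ℂ[x]/(det_n)) = ℤ`, Bruns–Vetter), so the guard `3 ≤ n` and the permanent's geometry are used.

## Proof (line `derivation-symbolic-square` of the crux chain; every step a tree theorem)

1. **Codimension of the singular locus** (von zur Gathen 1987, Lemma 2.3, PROVED in the tree as
   `vonzurGathen1987_singPerm_height_holds` / `five_le_height_of_singPermIdeal_le`): for `n ≥ 3`
   every prime of `ℂ[x]` containing `per_n` and all its partials `∂per_n/∂x_ij = per(x(i|j))` has
   height `≥ 5`.  With the bookkeeping `ht 𝔮 = ht P + 1` for the preimage `𝔮` of a prime `P` of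
   `S_n`, every prime of `S_n` of height `≤ 3` misses some partial upstairs
   (`PermHypersurfaceFactorial.stub_missingPartial`).
2. **Derivation test** (Jacobian criterion, regular direction; Matsumura Thm. 14.2): a derivation
   maps `𝔮²` into `𝔮`, so a missing partial puts `per_n ∉ 𝔪_𝔮²` in the regular local ring
   `ℂ[x]_𝔮`, whence `(S_n)_P ≅ ℂ[x]_𝔮/(per_n)` is regular
   (`PermHypersurfaceFactorial.stub_regular_of_pderiv_notMem`).  So `S_n` is regular in
   codimension `≤ 3` (`permQuot_isRegularLocalRing_of_height_le_three`).
3. **Grothendieck's theorem on Samuel's conjecture** (SGA 2 XI Cor. 3.14 with Thm. 3.13 (i),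
   hypersurface case, PROVED in the tree: `Grothendieck1968_samuelConjecture_hypersurface_holds`):
   a hypersurface ring `R/(f)`, `R` regular local, regular in codimension `≤ 3`, is factorial;
   applied at `R = ℂ[x]_𝔪` for every prime `𝔪 ⊇ (per_n)` and transported along
   `(S_n)_M ≅ ℂ[x]_𝔪/(per_n)`: every local ring of `S_n` is factorial
   (`PermHypersurfaceFactorial.stub_localFactorial`).
4. **Graded descent** (Fossum 1973, Cor. 10.3, normality-free tree form
   `uniqueFactorizationMonoid_of_atIrrelevant`): `S_n` is a noetherian domain (`per_n` irreducible,
   von zur Gathen Thm. 3.4, `perPoly_irreducible`), ℕ-graded by total degree with degree-`0` part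
   `ℂ`, and its irrelevant ideal is maximal; factorial there ⇒ `S_n` factorial
   (`PermHypersurfaceFactorial.stub_gradedDescent`).  Hence `S_n` is a UFD
   (`permQuot_isDomain_and_ufm`), and a height-one prime of a UFD is principal
   (Mathlib `UniqueFactorizationMonoid.isPrincipal_of_height_eq_one`).

Lead: `prover-line-stmt-ValiantsHypothesis-5666-0`; stub files
`UlrichPaddedPermHypersurfaceFactorial{MissingPartial,RegularOfPderiv,LocalFactorial,GradedDescent}.lean`.

## References

* [Vonzurgathen1987] J. von zur Gathen, *Permanent and determinant*, LAA 96 (1987), Lemma 2.3,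
  Thm. 3.4.
* [Grothendieck1968SGA2] A. Grothendieck, SGA 2, Exp. XI, Thm. 3.13, Cor. 3.14.
* [Matsumura1987] H. Matsumura, *Commutative Ring Theory*, Thm. 14.2, 14.3, 20.3.
* [Fossum1973] R. M. Fossum, *The Divisor Class Group of a Krull Domain*, Cor. 10.3, Prop. 6.1.
-/

noncomputable section

namespace Summit.ValiantsHypothesis.Theorems

open MvPolynomial IsLocalRing Literature.Computability.AlgebraicComplexity
open Summit.ValiantsHypothesis.Theorems.PermHypersurfaceFactorial

/-- **`S_n = ℂ[x_{n×n}]/(per_n)` is regular in codimension `≤ 3`** (`n ≥ 3`): the localisation at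
every prime of height `≤ 3` is a regular local ring — von zur Gathen's height bound (a prime of
height `≤ 3` misses a partial of `per_n`, `stub_missingPartial`) and the derivation test
(`stub_regular_of_pderiv_notMem`). [cite: Vonzurgathen1987, Lemma 2.3] -/
theorem permQuot_isRegularLocalRing_of_height_le_three {n : ℕ} (hn : 3 ≤ n)
    (Q : Ideal (MvPolynomial (Fin n × Fin n) ℂ ⧸ Ideal.span {perPoly (Fin n) ℂ})) [Q.IsPrime]
    (hQ : Q.height ≤ 3) : IsRegularLocalRing (Localization.AtPrime Q) := by
  obtain ⟨ij, hij⟩ := stub_missingPartial n hn Q hQ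
  exact stub_regular_of_pderiv_notMem (Fin n × Fin n) ℂ (perPoly (Fin n) ℂ) ij Q hij

/-- **The permanental hypersurface ring `ℂ[x_{n×n}]/(per_n)` is a factorial domain for `n ≥ 3`**
(a UFD): regular in codimension `≤ 3` (`permQuot_isRegularLocalRing_of_height_le_three`) ⇒ every
local ring factorial (Grothendieck, SGA 2 XI Cor. 3.14, `stub_localFactorial`) ⇒ factorial
(Fossum 1973 Cor. 10.3, graded descent, `stub_gradedDescent`).  False for `n = 2` and for the
determinant (`Cl = ℤ`). [cite: Grothendieck1968SGA2, Exp. XI Cor. 3.14] -/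
theorem permQuot_isDomain_and_ufm {n : ℕ} (hn : 3 ≤ n) :
    ∃ _ : IsDomain (MvPolynomial (Fin n × Fin n) ℂ ⧸ Ideal.span {perPoly (Fin n) ℂ}),
      UniqueFactorizationMonoid (MvPolynomial (Fin n × Fin n) ℂ ⧸ Ideal.span {perPoly (Fin n) ℂ}) :=
  stub_gradedDescent n hn fun M _ =>
    stub_localFactorial n hn
      (fun Q _ hQ => permQuot_isRegularLocalRing_of_height_le_three hn Q hQ) M

/-- **Crux `UlrichPadded.PermHypersurfaceFactorial` (stmt-ValiantsHypothesis-5666), proved:** for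
`n ≥ 3` every height-one prime ideal of `ℂ[x_{n×n}]/(per_n)` is principal — the ring is a UFD
(`permQuot_isDomain_and_ufm`) and a height-one prime of a UFD is principal
(`UniqueFactorizationMonoid.isPrincipal_of_height_eq_one`).  Line `derivation-symbolic-square`:
vzG codim-5 + derivation test ⇒ R₃; Grothendieck–Samuel ⇒ locally factorial; Fossum ⇒ factorial.
[cite: Grothendieck1968SGA2, Exp. XI Cor. 3.14] [cite: Fossum1973, Cor. 10.3] -/
theorem permHypersurfaceFactorial_proof :
    Summit.ValiantsHypothesis.ValiantsHypothesis.Theses.UlrichPadded.PermHypersurfaceFactorial := by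
  intro n hn P hP hht
  obtain ⟨hdom, hufm⟩ := permQuot_isDomain_and_ufm hn
  haveI := hP
  exact UniqueFactorizationMonoid.isPrincipal_of_height_eq_one hht

end Summit.ValiantsHypothesis.Theorems

end
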